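import Summits.QuantumAdvantage.QuantumAdvantage.Theorems.CubicForrelationNearExactIsExactTwelveTypeO932Shape
import Summits.QuantumAdvantage.QuantumAdvantage.Theorems.CubicForrelationNearExactIsExactRankTwoCeilingA

/-!
# Crux `CubicForrelation.NearExactIsExact` (stmt-QuantumAdvantage-14043) — n = 12, type O with the 9-FLAT base pattern (`#E = 512`) at
  `Φ ≥ 931/1024`: the single boundary configuration (ONE wild point, `8v = ±64`) and its death through the partner's residues

Certificate seat `b2b-cforr-cert` (gen 19).  HONEST FRAMING: kernel-checked lemmas (standard axioms) closing one boundary configuration of the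
rung `931/1024` at `n = 12`; NO new value of `θ₁₂` by itself (the base sets `896`, `960` and the level-`≥ 6` pairs of the window
`(930/1024, 932/1024)` remain).  NOT summit progress.

* `to19_typeO_E512_boundary`: cubic `f, g` on 12 bits, `W_g = 16u`, some `u(x)` odd, `#E = 512` (`E = {d₁ = d₂}` a 9-flat) and
  `Φ ≥ 931/1024`.  Then gen 12's relative 2-adic tower (`to12_cube_congr`, `to12_level`, `to12_excess`, as in `to15_typeO_E_ge_768`, whose
  excess budget `< 3712` becomes `≤ 3712`) still kills `[v odd]` (`256·16 = 4096`), `[v/2 odd]` (`64·160`), `[v/4 odd]` (`8·832`), so `8 ∣ v`;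
  a wild point costs `≥ 3712`, two cost too much, none gives `Φ = 15/16 > 59/64`: exactly ONE point `x₀` has `v(x₀) = ±8`, i.e.
  `u − 4(−1)^f = τ₀` off `x₀` and `= τ₀ ± 64` at `x₀` (and `Φ = 931/1024`).
* `to19_typeO_E512_ge931_false`: that configuration is impossible: Walsh inversion gives
  `16·u_f(y) = W_f(y) = 64(−1)^{g(y)} − T(y)/4 ∓ 16(−1)^{x₀·y}` with `T = τ̂₀ ∈ 4096·{0,±1} − 2048·{0,±1}` (the affine sign `(−1)^{d₁}` is a
  character, `ar_affine_signForm`; the 9-flat `E` has character sums `0, ±512`, `ktg2_minweight_twist_sum`), so `u_f ≡ 4(−1)^g ∓ 1 ≡ ±3 (mod 8)`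
  EVERYWHERE — the partner `f` would be a type-O cubic in case A, excluded by `TypeOTwelve.no_caseA`.
Consequence (with `…TwelveTypeO931Shape`): a type-O side with `Φ > 930/1024` has base set `896` or `960` — the same two configurations as at
`932/1024`, with excess budgets `< 768` resp. `< 256`.

References: Kasami–Tokura (1970); MacWilliams–Sloane (1977) Ch. 14–15; O'Donnell (2014) §1.4.  Axioms: the standard three.
-/

set_option linter.dupNamespace false -- D-0017: single-problem summit ⇒ `QuantumAdvantage.QuantumAdvantage` by design

noncomputable section

namespace Summit.QuantumAdvantage.QuantumAdvantage.Theorems.CubicForrelation.NearExactIsExact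

open Finset
open Literature.Computability.QuantumComplexity
open Literature.Computability.QuantumComplexity.BuzetChailloux (bxor zeroVec bxor_bxor_cancel_left bxor_zeroVec zeroVec_bxor bxor_comm
  bxor_self twist_zeroVec_right twist_bxor_right signOf_sq sum_twist_left)
open Literature.Computability.QuantumComplexity.DerivativeWalsh (W sum_W_sq)
open Literature.Computability.QuantumComplexity.Simon (twist_eq_one_or)
open Summit.QuantumAdvantage.QuantumAdvantage.Theorems.NearExactIsExact.Negative (TypeOTwelve.no_caseA TypeOTwelve.cube_sum_dvd
  TypeOTwelve.typeO_of_exists_odd)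
open Summit.QuantumAdvantage.QuantumAdvantage.Theorems.SignedCubicForrelationNotPrBPP (knf_isDegLeFun_ip)

/-! ### The boundary configuration of the 9-flat base pattern -/

/-- **Type O, `#E = 512`, `Φ ≥ 931/1024` on 12 bits: exactly one wild point, of height `±8`.**  Cubic `f, g` with `W_g = 16u`, some `u(x)`
odd, `#E = 512` and `Φ(f,g) ≥ 931/1024`: there is a point `x₀` such that `u(x) − 4(−1)^{f(x)} = τ₀(x)` for all `x ≠ x₀` and
`u(x₀) − 4(−1)^{f(x₀)} = τ₀(x₀) ± 64`, where `τ₀ = (−1)^{d₁}(1 − 4·1_E)` is the base pattern.  Finite-slice statement; NOT summit progress.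
[this work] -/
theorem to19_typeO_E512_boundary (f g : (Fin (6 + 6) → Bool) → Bool) (hf : IsDegLeFun 3 f) (hg : IsDegLeFun 3 g)
    (u : (Fin (6 + 6) → Bool) → ℤ) (hu : ∀ x, W (fun y => signOf (g y)) x = (2 : ℝ) ^ 4 * (u x : ℝ))
    (hodd : ∃ x, Odd (u x)) (hE512 : #(univ.filter fun x : Fin (6 + 6) → Bool => (Odd (u x / 2) ↔ Odd (u x / 2 / 2))) = 512)
    (hΦ : (931 / 1024 : ℝ) ≤ forrelation f g) :
    ∃ x₀ : Fin (6 + 6) → Bool,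
      (∀ x, x ≠ x₀ → u x - 4 * sZ (f x) =
        sZ (decide (Odd (u x / 2))) * (1 - 4 * (if (Odd (u x / 2) ↔ Odd (u x / 2 / 2)) then 1 else 0))) ∧
      (u x₀ - 4 * sZ (f x₀) = sZ (decide (Odd (u x₀ / 2))) * (1 - 4 * (if (Odd (u x₀ / 2) ↔ Odd (u x₀ / 2 / 2)) then 1 else 0)) + 64 ∨
        u x₀ - 4 * sZ (f x₀) = sZ (decide (Odd (u x₀ / 2))) * (1 - 4 * (if (Odd (u x₀ / 2) ↔ Odd (u x₀ / 2 / 2)) then 1 else 0)) - 64) := by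
  classical
  have hΦle : forrelation f g ≤ 59 / 64 := to12_typeO_le f g hf hg u hu hodd
  have hall : ∀ x, Odd (u x) := TypeOTwelve.typeO_of_exists_odd g u hg hu hodd
  have hu' : ∀ x, W (fun y => signOf (g y)) x = (2 : ℝ) ^ (2 * 2) * (u x : ℝ) := fun x => (hu x).trans (by norm_num)
  have hd1 : IsDegLeFun 1 (fun x => decide (Odd (u x / 2))) := z2_digitOne 2 g u hg hu' hall
  have hd2 : IsDegLeFun 3 (fun x => decide (Odd (u x / 2 / 2))) := z2_digitTwo 2 g u hg hu' hall
  set E := univ.filter (fun x : Fin (6 + 6) → Bool => (Odd (u x / 2) ↔ Odd (u x / 2 / 2))) with hEdef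
  have hmemE : ∀ x, x ∈ E ↔ (Odd (u x / 2) ↔ Odd (u x / 2 / 2)) := fun x => by simp [hEdef]
  have hdegE : IsDegLeFun (2 + 1) (fun x => (decide (Odd (u x / 2)) ^^ decide (Odd (u x / 2 / 2))) ^^ true) :=
    tb_isDegLeFun_xor_const (bb_isDegLeFun_bxor (hd1.mono (by norm_num)) hd2) true
  have hsetE : (univ.filter fun x : Fin (6 + 6) → Bool =>
      ((decide (Odd (u x / 2)) ^^ decide (Odd (u x / 2 / 2))) ^^ true) = true) = E := by
    rw [hEdef]
    apply filter_congr
    intro x _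
    by_cases h1 : Odd (u x / 2) <;> by_cases h2 : Odd (u x / 2 / 2) <;> simp [h1, h2]
  have hsumE : (∑ x, (if (Odd (u x / 2) ↔ Odd (u x / 2 / 2)) then 1 else 0 : ℤ)) = #E := by rw [sum_boole]
  -- budget `Σ τ² = 2¹⁷(1 − Φ) ≤ 11904`
  have hbud := tw12_budget f g u hu
  have hT : (∑ x, (u x - 4 * sZ (f x)) ^ 2 : ℤ) ≤ 11904 := by
    have h' : ((∑ x, (u x - 4 * sZ (f x)) ^ 2 : ℤ) : ℝ) ≤ 11904 := by rw [hbud]; linarith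
    exact_mod_cast h'
  -- base pattern `τ₀` and wild function `v`: `τ = τ₀ + 8v`
  choose v hv using fun x => to12_pt_mod8 (u x) (sZ (f x)) (hall x) (tp_sZ_cases (f x))
  set τ₀ : (Fin (6 + 6) → Bool) → ℤ := fun x =>
    sZ (decide (Odd (u x / 2))) * (1 - 4 * (if (Odd (u x / 2) ↔ Odd (u x / 2 / 2)) then 1 else 0)) with hτ₀def
  have hvx : ∀ x, u x - 4 * sZ (f x) = τ₀ x + 8 * v x := fun x => hv x
  have hτ₀val : ∀ x, τ₀ x = 1 ∨ τ₀ x = -1 ∨ τ₀ x = 3 ∨ τ₀ x = -3 := by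
    intro x
    simp only [τ₀]
    rcases tp_sZ_cases (decide (Odd (u x / 2))) with h | h <;> rw [h] <;> split_ifs <;> norm_num
  have hτ₀sq : ∀ x, τ₀ x ^ 2 = 1 + 8 * (if (Odd (u x / 2) ↔ Odd (u x / 2 / 2)) then 1 else 0 : ℤ) := by
    intro x
    simp only [τ₀]
    rcases tp_sZ_cases (decide (Odd (u x / 2))) with h | h <;> rw [h] <;> split_ifs <;> norm_num
  have hsumτ₀ : ∑ x, τ₀ x ^ 2 = 4096 + 8 * #E := by
    rw [sum_congr rfl fun x _ => hτ₀sq x, sum_add_distrib, ← mul_sum, hsumE, sum_const, card_univ, Fintype.card_fun,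
      Fintype.card_bool, Fintype.card_fin]
    norm_num
  -- excess decomposition `Σ τ² = Σ τ₀² + Σ X`, `X ≥ 0`
  set X : (Fin (6 + 6) → Bool) → ℤ := fun x => (τ₀ x + 8 * v x) ^ 2 - τ₀ x ^ 2 with hXdef
  have hXnn : ∀ x, 0 ≤ X x := fun x => to12_excess_nonneg _ _ (hτ₀val x)
  have hTdec : (∑ x, (u x - 4 * sZ (f x)) ^ 2 : ℤ) = ∑ x, τ₀ x ^ 2 + ∑ x, X x := by
    rw [← sum_add_distrib]
    exact sum_congr rfl fun x _ => by rw [hvx x]; simp only [X]; ring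
  have hXsum : ∑ x, X x ≤ 3712 := by
    have : (∑ x, (u x - 4 * sZ (f x)) ^ 2 : ℤ) = 8192 + ∑ x, X x := by rw [hTdec, hsumτ₀, hE512]; norm_num
    linarith
  -- `E` is a 9-flat
  have hmwE := mw_flat_of_minweight 2 _ hdegE (by rw [hsetE, hE512]; norm_num)
  rw [hsetE] at hmwE
  obtain ⟨h0E, haddE, hcardVE, hcosetE⟩ := hmwE
  set VE := univ.filter (fun a : Fin (6 + 6) → Bool => ∀ x,
    ((decide (Odd (u (bxor x a) / 2)) ^^ decide (Odd (u (bxor x a) / 2 / 2))) ^^ true) =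
      ((decide (Odd (u x / 2)) ^^ decide (Odd (u x / 2 / 2))) ^^ true)) with hVE
  rw [hE512] at hcardVE
  have hEpos : 0 < #E := by rw [hE512]; norm_num
  obtain ⟨xE, hxE⟩ : E.Nonempty := card_pos.1 hEpos
  have hSE : E = VE.image (bxor xE) := hcosetE xE (by
    have h := (hmemE xE).1 hxE
    by_cases h1 : Odd (u xE / 2)
    · have h2 : Odd (u xE / 2 / 2) := h.1 h1
      simp [h1, h2]
    · have h2 : ¬ Odd (u xE / 2 / 2) := fun h' => h1 (h.2 h')
      simp [h1, h2])
  -- the wild identity in coset form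
  have hv' : ∀ x, u x - 4 * sZ (f x) =
      sZ (decide (Odd (u x / 2))) * (1 - 4 * (if x ∈ VE.image (bxor xE) then 1 else 0)) + 8 * v x := by
    intro x
    rw [← hSE, hvx x]
    simp only [τ₀]
    by_cases hx : (Odd (u x / 2) ↔ Odd (u x / 2 / 2))
    · rw [if_pos hx, if_pos ((hmemE x).2 hx)]
    · rw [if_neg hx, if_neg (fun h' => hx ((hmemE x).1 h'))]
  have hcc := fun I => to12_cube_congr f g hf hg u hu hd1 VE xE h0E haddE hcardVE v hv' I
  -- excess of a set of wild points
  have hXset : ∀ (S : Finset (Fin (6 + 6) → Bool)) (c : ℤ), 1 ≤ c → (∀ x ∈ S, c ≤ v x ∨ v x ≤ -c) →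
      16 * c * (4 * c - 3) * #S ≤ ∑ x, X x := by
    intro S c hc hS
    calc 16 * c * (4 * c - 3) * #S = ∑ x ∈ S, 16 * c * (4 * c - 3) := by rw [sum_const, nsmul_eq_mul, mul_comm]
      _ ≤ ∑ x ∈ S, X x := sum_le_sum fun x hx => to12_excess _ _ c (hτ₀val x) hc (hS x hx)
      _ ≤ ∑ x, X x := sum_le_sum_of_subset_of_nonneg (subset_univ _) fun x _ _ => hXnn x
  -- LEVEL 1: `v` is even
  have hv2 : ∀ x, Even (v x) := by
    rcases to12_level v 4 (fun I hI => (hcc I).1 (by omega)) with h | h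
    · exact h
    · exfalso
      have hcnt : (256 : ℤ) ≤ #(univ.filter fun x => Odd (v x)) := by norm_num at h; exact_mod_cast (by omega)
      have hge := hXset (univ.filter fun x => Odd (v x)) 1 le_rfl (fun x hx => by
        obtain ⟨k, hk⟩ := (mem_filter.1 hx).2; omega)
      linarith
  choose v₁ hv₁ using hv2
  have hvv₁ : ∀ x, v x = 2 * v₁ x := fun x => by rw [two_mul]; exact hv₁ x
  -- LEVEL 2: `v/2` is even
  have hv4 : ∀ x, Even (v₁ x) := by
    rcases to12_level v₁ 6 (fun I hI => by
      have h4 := (hcc I).2.1 (by omega)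
      rw [sum_congr rfl (fun x _ => hvv₁ x), ← mul_sum] at h4
      omega) with h | h
    · exact h
    · exfalso
      have hcnt : (64 : ℤ) ≤ #(univ.filter fun x => Odd (v₁ x)) := by norm_num at h; exact_mod_cast (by omega)
      have hge := hXset (univ.filter fun x => Odd (v₁ x)) 2 (by norm_num) (fun x hx => by
        obtain ⟨k, hk⟩ := (mem_filter.1 hx).2; have := hvv₁ x; omega)
      linarith
  choose v₂ hv₂ using hv4
  have hvv₂ : ∀ x, v x = 4 * v₂ x := fun x => by rw [hvv₁ x, hv₂ x]; ring
  -- LEVEL 3: `v/4` is even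
  have hv8 : ∀ x, Even (v₂ x) := by
    rcases to12_level v₂ 9 (fun I hI => by
      have h8 := (hcc I).2.2 (by omega)
      rw [sum_congr rfl (fun x _ => hvv₂ x), ← mul_sum] at h8
      omega) with h | h
    · exact h
    · exfalso
      have hcnt : (8 : ℤ) ≤ #(univ.filter fun x => Odd (v₂ x)) := by norm_num at h; exact_mod_cast (by omega)
      have hge := hXset (univ.filter fun x => Odd (v₂ x)) 4 (by norm_num) (fun x hx => by
        obtain ⟨k, hk⟩ := (mem_filter.1 hx).2; have := hvv₂ x; omega)
      linarith
  -- LEVEL 4: a wild point costs `≥ 3712`; two are too many, none gives `Φ = 15/16`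
  have hX8 : ∀ x, v x ≠ 0 → 3712 ≤ X x := by
    intro x hx
    have h8 : 8 ≤ v x ∨ v x ≤ -8 := by obtain ⟨k, hk⟩ := hv8 x; have := hvv₂ x; omega
    have h1 := to12_excess _ _ 8 (hτ₀val x) (by norm_num) h8
    simp only [X]; linarith
  have hsome : ∃ x₀, v x₀ ≠ 0 := by
    by_contra hnone
    push Not at hnone
    have hT8192 : (∑ x, (u x - 4 * sZ (f x)) ^ 2 : ℤ) = 8192 := by
      rw [hTdec, hsumτ₀, hE512, sum_eq_zero (fun x _ => by simp only [X]; rw [hnone x]; ring)]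
      norm_num
    have hΦeq : forrelation f g = 15 / 16 := by
      have h : ((∑ x, (u x - 4 * sZ (f x)) ^ 2 : ℤ) : ℝ) = 8192 := by exact_mod_cast hT8192
      rw [hbud] at h
      linarith
    rw [hΦeq] at hΦle
    norm_num at hΦle
  obtain ⟨x₀, hx₀⟩ := hsome
  have hothers : ∀ x, x ≠ x₀ → v x = 0 := by
    intro x hx
    by_contra hvx0
    have h2 : X x + X x₀ ≤ ∑ y, X y := by
      rw [← sum_pair hx]
      exact sum_le_sum_of_subset_of_nonneg (subset_univ _) fun y _ _ => hXnn y
    linarith [hX8 x hvx0, hX8 x₀ hx₀]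
  have hv16 : v x₀ = 8 ∨ v x₀ = -8 := by
    by_contra hcon
    have h16 : 16 ≤ v x₀ ∨ v x₀ ≤ -16 := by
      obtain ⟨k, hk⟩ := hv8 x₀; have := hvv₂ x₀; omega
    have h1 := to12_excess _ _ 16 (hτ₀val x₀) (by norm_num) h16
    have h2 : X x₀ ≤ ∑ y, X y := single_le_sum (fun y _ => hXnn y) (mem_univ x₀)
    simp only [X] at h2
    linarith
  refine ⟨x₀, fun x hx => ?_, ?_⟩
  · have h := hvx x; rw [hothers x hx] at h; simp only [τ₀] at h; linarith
  · have h := hvx x₀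
    simp only [τ₀] at h
    rcases hv16 with h8 | h8 <;> rw [h8] at h
    · left; linarith
    · right; linarith

/-! ### The partner's residues: the boundary configuration is dead -/

/-- **The 9-flat base pattern does not reach `931/1024`.**  Cubic `f, g : 𝔽₂¹² → 𝔽₂` with `W_g = 16u`, some `u(x)` odd and `#E = 512`:
then `Φ(f,g) < 931/1024`.  By `to19_typeO_E512_boundary` the wild function is `±8·δ_{x₀}`; Walsh inversion then gives
`u_f(y) = 4(−1)^{g(y)} − 64α(y) + 32β(y) ∓ (−1)^{x₀·y}` (`α, β ∈ {0, ±1}` from the affine sign `(−1)^{d₁} = ±(−1)^{a·x}` and the character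
sums `0, ±512` of the 9-flat `E`), so `u_f ≡ ±3 (mod 8)` everywhere and the cubic `f` would be type O in case A — impossible
(`TypeOTwelve.no_caseA`).  With `to15_typeO_E_ge_768` (`Φ > 931/1024 ⇒ #E ≥ 768`) this removes `#E = 512` from the whole rung `931/1024`.
Finite-slice statement; NOT summit progress. [this work] -/
theorem to19_typeO_E512_ge931_false (f g : (Fin (6 + 6) → Bool) → Bool) (hf : IsDegLeFun 3 f) (hg : IsDegLeFun 3 g)
    (u : (Fin (6 + 6) → Bool) → ℤ) (hu : ∀ x, W (fun y => signOf (g y)) x = (2 : ℝ) ^ 4 * (u x : ℝ))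
    (hodd : ∃ x, Odd (u x)) (hE512 : #(univ.filter fun x : Fin (6 + 6) → Bool => (Odd (u x / 2) ↔ Odd (u x / 2 / 2))) = 512)
    (hΦ : (931 / 1024 : ℝ) ≤ forrelation f g) : False := by
  classical
  have hall : ∀ x, Odd (u x) := TypeOTwelve.typeO_of_exists_odd g u hg hu hodd
  have hu' : ∀ x, W (fun y => signOf (g y)) x = (2 : ℝ) ^ (2 * 2) * (u x : ℝ) := fun x => (hu x).trans (by norm_num)
  have hd1 : IsDegLeFun 1 (fun x => decide (Odd (u x / 2))) := z2_digitOne 2 g u hg hu' hall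
  have hd2 : IsDegLeFun 3 (fun x => decide (Odd (u x / 2 / 2))) := z2_digitTwo 2 g u hg hu' hall
  set E := univ.filter (fun x : Fin (6 + 6) → Bool => (Odd (u x / 2) ↔ Odd (u x / 2 / 2))) with hEdef
  have hmemE : ∀ x, x ∈ E ↔ (Odd (u x / 2) ↔ Odd (u x / 2 / 2)) := fun x => by simp [hEdef]
  have hdegE : IsDegLeFun (2 + 1) (fun x => (decide (Odd (u x / 2)) ^^ decide (Odd (u x / 2 / 2))) ^^ true) :=
    tb_isDegLeFun_xor_const (bb_isDegLeFun_bxor (hd1.mono (by norm_num)) hd2) true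
  have hsetE : (univ.filter fun x : Fin (6 + 6) → Bool =>
      ((decide (Odd (u x / 2)) ^^ decide (Odd (u x / 2 / 2))) ^^ true) = true) = E := by
    rw [hEdef]
    apply filter_congr
    intro x _
    by_cases h1 : Odd (u x / 2) <;> by_cases h2 : Odd (u x / 2 / 2) <;> simp [h1, h2]
  -- the boundary configuration
  obtain ⟨x₀, hoff, hx₀⟩ := to19_typeO_E512_boundary f g hf hg u hu hodd hE512 hΦ
  obtain ⟨ε, hε, hwild⟩ : ∃ ε : ℤ, (ε = 1 ∨ ε = -1) ∧ ∀ x, u x - 4 * sZ (f x) =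
      sZ (decide (Odd (u x / 2))) * (1 - 4 * (if (Odd (u x / 2) ↔ Odd (u x / 2 / 2)) then 1 else 0)) +
        64 * ε * (if x = x₀ then 1 else 0) := by
    rcases hx₀ with h | h
    · refine ⟨1, Or.inl rfl, fun x => ?_⟩
      by_cases hx : x = x₀
      · rw [if_pos hx, hx, h]; ring
      · rw [if_neg hx, hoff x hx]; ring
    · refine ⟨-1, Or.inr rfl, fun x => ?_⟩
      by_cases hx : x = x₀
      · rw [if_pos hx, hx, h]; ring
      · rw [if_neg hx, hoff x hx]; ring
  -- the partner's normalised spectrum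
  obtain ⟨uf, huf⟩ := tw_base (n := 6 + 6) f hf 4 (by norm_num)
  -- the affine sign `(−1)^{d₁}` is a character
  obtain ⟨c, a, hca⟩ := ar_affine_signForm stub_derivDegree hd1
  -- character sums of the 9-flat `E`
  have hEsum : ∀ z, (∑ x ∈ E, twist x z) = 0 ∨ (∑ x ∈ E, twist x z) = 512 ∨ (∑ x ∈ E, twist x z) = -512 := by
    intro z
    have h := ktg2_minweight_twist_sum _ hdegE (by rw [hsetE, hE512]; norm_num) z
    rw [hsetE, hE512] at h
    push_cast at h
    exact h
  -- Walsh inversion for `g`: `Σ_x u(x) (−1)^{x·y} = 256 (−1)^{g(y)}`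
  have hinv : ∀ y, ∑ x, (u x : ℝ) * twist x y = 256 * signOf (g y) := by
    intro y
    have h := tz_inversion (fun z => signOf (g z)) y
    rw [sum_congr rfl fun x _ => by rw [hu x]] at h
    have e : ∑ x, (2 : ℝ) ^ 4 * (u x : ℝ) * twist x y = 2 ^ 4 * ∑ x, (u x : ℝ) * twist x y := by
      rw [mul_sum]; exact sum_congr rfl fun x _ => by ring
    rw [e] at h
    have h' : (2 : ℝ) ^ 4 * (∑ x, (u x : ℝ) * twist x y - 256 * signOf (g y)) = 0 := by
      rw [mul_sub, h]; norm_num; ring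
    have h2 : (2 : ℝ) ^ 4 ≠ 0 := by positivity
    linarith [(mul_eq_zero.1 h').resolve_left h2]
  -- the residue identity for `u_f`
  have hres : ∀ y, ∃ A B T : ℤ, (A = 0 ∨ A = 1 ∨ A = -1) ∧ (B = 0 ∨ B = 1 ∨ B = -1) ∧ (T = 1 ∨ T = -1) ∧
      uf y = 4 * sZ (g y) - 64 * A + 32 * B - ε * T := by
    intro y
    -- `α`: the full character sum
    obtain ⟨A, hA, hAsum⟩ : ∃ A : ℤ, (A = 0 ∨ A = 1 ∨ A = -1) ∧
        signOf c * ∑ x : Fin (6 + 6) → Bool, twist x (bxor a y) = 4096 * (A : ℝ) := by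
      rw [sum_twist_left]
      split_ifs
      · cases c
        · exact ⟨1, Or.inr (Or.inl rfl), by norm_num [signOf]⟩
        · exact ⟨-1, Or.inr (Or.inr rfl), by norm_num [signOf]⟩
      · exact ⟨0, Or.inl rfl, by simp⟩
    -- `β`: the character sum over the flat
    obtain ⟨B, hB, hBsum⟩ : ∃ B : ℤ, (B = 0 ∨ B = 1 ∨ B = -1) ∧
        signOf c * ∑ x ∈ E, twist x (bxor a y) = 512 * (B : ℝ) := by
      rcases hEsum (bxor a y) with h | h | h <;> rw [h]
      · exact ⟨0, Or.inl rfl, by simp⟩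
      · cases c
        · exact ⟨1, Or.inr (Or.inl rfl), by norm_num [signOf]⟩
        · exact ⟨-1, Or.inr (Or.inr rfl), by norm_num [signOf]⟩
      · cases c
        · exact ⟨-1, Or.inr (Or.inr rfl), by norm_num [signOf]⟩
        · exact ⟨1, Or.inr (Or.inl rfl), by norm_num [signOf]⟩
    -- `T`: the character of the wild point
    obtain ⟨T, hT, hTw⟩ : ∃ T : ℤ, (T = 1 ∨ T = -1) ∧ twist x₀ y = (T : ℝ) := by
      rcases twist_eq_one_or x₀ y with h | h
      · exact ⟨1, Or.inl rfl, by rw [h]; norm_num⟩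
      · exact ⟨-1, Or.inr rfl, by rw [h]; norm_num⟩
    refine ⟨A, B, T, hA, hB, hT, ?_⟩
    -- `4 W_f(y) = Σ u twist − Σ τ₀ twist − 64 ε (−1)^{x₀·y}`
    have hWf : W (fun x => signOf (f x)) y = 2 ^ 4 * (uf y : ℝ) := huf y
    have hsf : ∀ x, signOf (f x) = ((u x : ℝ) - (sZ (decide (Odd (u x / 2))) : ℝ) * (1 - 4 * (if x ∈ E then (1 : ℝ) else 0)) -
        64 * ε * (if x = x₀ then (1 : ℝ) else 0)) / 4 := by
      intro x
      have h := hwild x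
      rw [← tp_sZ_cast]
      have h' : ((u x - 4 * sZ (f x) : ℤ) : ℝ) = ((sZ (decide (Odd (u x / 2))) * (1 - 4 * (if (Odd (u x / 2) ↔ Odd (u x / 2 / 2)) then 1 else 0)) +
          64 * ε * (if x = x₀ then 1 else 0) : ℤ) : ℝ) := by rw [h]
      push_cast at h'
      have e1 : (if (Odd (u x / 2) ↔ Odd (u x / 2 / 2)) then (1 : ℝ) else 0) = (if x ∈ E then (1 : ℝ) else 0) := by
        by_cases hx : (Odd (u x / 2) ↔ Odd (u x / 2 / 2))
        · rw [if_pos hx, if_pos ((hmemE x).2 hx)]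
        · rw [if_neg hx, if_neg (fun h => hx ((hmemE x).1 h))]
      rw [e1] at h'
      linarith
    have hτsum : ∑ x, (sZ (decide (Odd (u x / 2))) : ℝ) * (1 - 4 * (if x ∈ E then (1 : ℝ) else 0)) * twist x y =
        4096 * A - 4 * (512 * B) := by
      have e : ∀ x, (sZ (decide (Odd (u x / 2))) : ℝ) * (1 - 4 * (if x ∈ E then (1 : ℝ) else 0)) * twist x y =
          signOf c * twist x (bxor a y) - 4 * (if x ∈ E then signOf c * twist x (bxor a y) else 0) := by
        intro x
        rw [tp_sZ_cast, hca x, twist_bxor_right]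
        split_ifs <;> ring
      have hS2 : ∑ x, (if x ∈ E then signOf c * twist x (bxor a y) else 0) = 512 * (B : ℝ) := by
        rw [← sum_filter, filter_mem_eq_inter, univ_inter, ← mul_sum]; exact hBsum
      rw [sum_congr rfl fun x _ => e x, sum_sub_distrib, ← mul_sum, ← mul_sum, hAsum, hS2]
    have h4W : 4 * W (fun x => signOf (f x)) y = 256 * signOf (g y) - (4096 * A - 4 * (512 * B)) - 64 * ε * (T : ℝ) := by
      unfold W
      rw [← hinv y, ← hτsum, ← hTw, mul_sum]
      have e : ∀ x, 4 * (signOf (f x) * twist x y) = (u x : ℝ) * twist x y -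
          (sZ (decide (Odd (u x / 2))) : ℝ) * (1 - 4 * (if x ∈ E then (1 : ℝ) else 0)) * twist x y -
          64 * ε * ((if x = x₀ then (1 : ℝ) else 0) * twist x y) := by
        intro x; rw [hsf x]; ring
      rw [sum_congr rfl fun x _ => e x, sum_sub_distrib, sum_sub_distrib, ← mul_sum]
      congr 1
      rw [show (∑ x, (if x = x₀ then (1 : ℝ) else 0) * twist x y) = twist x₀ y by
        simp only [ite_mul, one_mul, zero_mul, Finset.sum_ite_eq', mem_univ, if_true]]
    rw [hWf] at h4W
    have hfin : ((uf y : ℤ) : ℝ) = ((4 * sZ (g y) - 64 * A + 32 * B - ε * T : ℤ) : ℝ) := by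
      push_cast; rw [tp_sZ_cast]; linarith
    exact_mod_cast hfin
  -- so `u_f ≡ ±3 (mod 8)` everywhere: case A for the partner
  refine TypeOTwelve.no_caseA f uf hf huf fun y => ?_
  obtain ⟨A, B, T, hA, hB, hT, hy⟩ := hres y
  rcases tp_sZ_cases (g y) with hs | hs <;> rw [hs] at hy <;> rcases hε with rfl | rfl <;> rcases hT with rfl | rfl <;> omega

end Summit.QuantumAdvantage.QuantumAdvantage.Theorems.CubicForrelation.NearExactIsExact

end
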